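import Mathlib.Algebra.Group.Submonoid.Operations
import Mathlib.Algebra.Group.Pi.Lemmas
import Mathlib.Data.Set.Image
import Literature.IUT.HodgeArakelov.BadPrimeGaussianMonoidsProofs2
import Literature.IUT.HodgeArakelov.BadPrimeGaussianMonoidsProofs3

/-!
# [IUTchII] Cor 3.5 (ii), `∞`-level: the restriction isomorphism `∞Ψ^ι_env ⥲ ∞Ψ_ξ` for the printed
# `ξ^{ℚ≥0}` ("roots that arise by restriction"), restriction typed OUT OF THE MONOID — proof companion of
# `BadPrimeGaussianMonoids.lean`

S. Mochizuki, *Inter-universal Teichmüller theory II*, §3, kurims Dec-2020 manuscript, Cor 3.5 (ii)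
p. 95: "the lower/middle horizontal arrows [`Ψ^ι_env ⥲ Ψ_ξ`, `∞Ψ^ι_env ⥲ ∞Ψ_ξ`] are isomorphisms of
monoids", where (p. 95 ll. 2–6) "`ξ^{ℚ≥0}` denotes the submonoid generated by the `N`-th roots [for
`N ∈ ℕ_{≥1}`] of `ξ` [which are uniquely determined, up to multiplication by an element of the `N`-torsion
subgroup of `Ψ^×_cns(M^Θ_*)_{⟨F_l^⋇⟩}`!] that ARISE BY RESTRICTING elements of `∞θ^ι_env(M^Θ_*)`"; Remark 3.6.1
p. 101 ("involving the monoids `∞Ψ` [i.e., not just the monoids `Ψ`!]") [cite: Mochizuki2012, Cor 3.5 (ii) p.95].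
Claim key DISPUTED (D-0012). PROOF-ONLY companion (abc-iut cell, layer L6, seat abc-iut-w5-d031; RQ7 finding
F1 on p412003 — the `∞`-clause of node IUTchII:Cor3.5(ii) — with the retyping of finding d017-F1-1
(abc-iut-w4-d017): restriction morphisms are typed OUT OF THE MONOID `∞Ψ^ι_env`, not out of the ambient
group, so that a theta value may restrict to a NON-unit of the constant monoid; object-level content of
Cor 3.5 by abc-iut-w4-d004 (Proofs2/3/4) and abc-iut-L6-t2 (statement file)). NO definition, NO `Prop` fact.

The statement file records `∞Ψ_ξ := Ψ^×_{⟨F_l^⋇⟩} · ξ^{ℚ≥0}` with `ξ^{ℚ≥0}` OVER-APPROXIMATED by ALL solutions of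
`x^a = ξ^b` (`rootPowers`, documented slack B6), for which restriction is only an inclusion and — kernel
witness in the seat's RQ7 file — in general NOT onto. Here the printed monoid is written RELATIVE TO THE
RESTRICTION DATA, with no new definition: for restriction morphisms `r_t : A →* M` out of a monoid `A`
(`= ∞Ψ^ι_env = M^×_TM · ⟨∞θ^ι_env⟩`) with unit part `U` and root part `Θ`, it is the submonoid
`unitDiagonal T M ⊔ Submonoid.closure (MonoidHom.pi r '' Θ)` of `∏_{|t|} Ψ_cns,|t| = (T → M)` generated by the
diagonal units and the restrictions of the roots. We PROVE: it IS the image of `A` under restriction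
(`mrange_pi_eq_inftyArising`); it lies inside the statement file's `∞Ψ_ξ` (`inftyArising_le_inftyGaussianMonoid`)
and contains `Ψ_ξ` (`gaussianMonoid_le_inftyArising`); and, given injectivity of the restriction at ONE label,
"the middle horizontal arrow is an isomorphism": a UNIQUE isomorphism `A ⥲ Ψ^×_{⟨F_l^⋇⟩} · ξ^{ℚ≥0}` whose
underlying map IS the restriction (`exists_inftyRestrictionIso`, `inftyRestrictionIso_unique`), in
particular for the typed `∞Ψ^ι_env(M^Θ_*)` of Proposition 3.1 (`exists_unique_inftyRestrictionIso_inftyThetaMonoid`),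
compatibly with the `Ψ`-level arrow (`restriction_inclusion_compatible`), together with the `∞`-row of
the Cor 3.6 (ii) diagram `∞Ψ_{†F^Θ_v,α} ⥲ ∞Ψ^ι_env ⥲ ∞Ψ_ξ ⥲ ∞Ψ_{F_ξ}` (`exists_inftyKummerRestrictionTransportIso`).

Nothing here asserts a disputed claim or takes a side on [IUTchIII] Cor 3.12; typed ≠ proved ≠ endorsed.
-/

namespace Literature.IUT.HodgeArakelov

namespace BadPrimeGaussianMonoids

open TemperedThetaMonoids

universe u v w

/-! ### 1. Restriction out of a monoid: the printed `∞Ψ_ξ` as the image, and its two comparisons -/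

section Arising

variable {A : Type u} [CommMonoid A] {T : Type v} {M : Type w} [CommMonoid M]

/-- **IUTchII:Cor3.5(ii)/(iii)** (kurims p.95), unit factor, restriction typed out of the monoid: if the unit
part `U` (`= M^×_TM`) restricts to diagonal unit families and every diagonal unit family so arises
(`Ψ^×_cns = M^×_TM` restricted label-independently, Cor 3.5 (i)), the image of `U` is the unit diagonal
`Ψ^×_{⟨F_l^⋇⟩}`. [cite: Mochizuki2012, Cor 3.5 (iii) p.95] -/
theorem map_unitPart_eq_unitDiagonal (U : Submonoid A) (r : T → (A →* M))
    (hU : ∀ u ∈ U, ∃ m : Mˣ, ∀ t, r t u = m) (hUsurj : ∀ m : Mˣ, ∃ u ∈ U, ∀ t, r t u = m) :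
    U.map (MonoidHom.pi r) = unitDiagonal T M := by
  apply le_antisymm
  · rintro _ ⟨u, hu, rfl⟩
    obtain ⟨m, hm⟩ := hU u hu
    exact ⟨m, funext fun t => by rw [MonoidHom.pi_apply, hm t]⟩
  · rintro _ ⟨m, rfl⟩
    obtain ⟨u, hu, hm⟩ := hUsurj m
    exact ⟨u, hu, funext fun t => by rw [MonoidHom.pi_apply, hm t]⟩

/-- **IUTchII:Cor3.5(ii)** (kurims p.95) "`ξ^{ℚ≥0}` … the `N`-th roots … that arise by restricting elements of
`∞θ^ι_env(M^Θ_*)`": restriction carries `U · ⟨Θ⟩` (`= M^×_TM · ⟨∞θ^ι_env⟩`) ONTO `Ψ^×_{⟨F_l^⋇⟩} · ⟨restrictions of Θ⟩`.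
[cite: Mochizuki2012, Cor 3.5 (ii) p.95] -/
theorem map_sup_closure_eq_inftyArising (U : Submonoid A) (Θ : Set A) (r : T → (A →* M))
    (hU : ∀ u ∈ U, ∃ m : Mˣ, ∀ t, r t u = m) (hUsurj : ∀ m : Mˣ, ∃ u ∈ U, ∀ t, r t u = m) :
    (U ⊔ Submonoid.closure Θ).map (MonoidHom.pi r) =
      unitDiagonal T M ⊔ Submonoid.closure (MonoidHom.pi r '' Θ) := by
  rw [Submonoid.map_sup, map_unitPart_eq_unitDiagonal U r hU hUsurj, MonoidHom.map_mclosure]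

/-- **IUTchII:Cor3.5(ii)** (kurims p.95): when the source monoid IS `M^×_TM · ⟨∞θ^ι_env⟩` (generated by its unit
part and its roots), the IMAGE of the restriction is exactly the printed `∞Ψ_ξ = Ψ^×_{⟨F_l^⋇⟩} · ξ^{ℚ≥0}`.
[cite: Mochizuki2012, Cor 3.5 (ii) p.95] -/
theorem mrange_pi_eq_inftyArising (U : Submonoid A) (Θ : Set A) (r : T → (A →* M))
    (hgen : U ⊔ Submonoid.closure Θ = ⊤)
    (hU : ∀ u ∈ U, ∃ m : Mˣ, ∀ t, r t u = m) (hUsurj : ∀ m : Mˣ, ∃ u ∈ U, ∀ t, r t u = m) :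
    MonoidHom.mrange (MonoidHom.pi r) = unitDiagonal T M ⊔ Submonoid.closure (MonoidHom.pi r '' Θ) := by
  rw [MonoidHom.mrange_eq_map, ← hgen, map_sup_closure_eq_inftyArising U Θ r hU hUsurj]

/-- **IUTchII:Cor3.5(ii)** (kurims p.95): the printed `∞Ψ_ξ` (roots arising by restriction) lies inside the
statement file's `inftyGaussianMonoid ξ` (ALL roots of powers of `ξ = (r_t θ)_t`) as soon as every element
of `Θ = ∞θ^ι_env` is a root of a power of `θ`. [cite: Mochizuki2012, Cor 3.5 (ii) p.95] -/
theorem inftyArising_le_inftyGaussianMonoid (θ : A) (Θ : Set A) (r : T → (A →* M))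
    (hroot : ∀ x ∈ Θ, ∃ a b : ℕ, 0 < a ∧ 0 < b ∧ x ^ a = θ ^ b) :
    unitDiagonal T M ⊔ Submonoid.closure (MonoidHom.pi r '' Θ) ≤ inftyGaussianMonoid (fun t => r t θ) := by
  refine sup_le le_sup_left ?_
  rw [Submonoid.closure_le]
  rintro _ ⟨x, hx, rfl⟩
  obtain ⟨a, b, ha, hb, hab⟩ := hroot x hx
  refine Submonoid.mem_sup_right (Submonoid.subset_closure ⟨a, b, ha, hb, funext fun t => ?_⟩)
  rw [Pi.pow_apply, Pi.pow_apply, MonoidHom.pi_apply, ← map_pow, ← map_pow, hab]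

/-- **IUTchII:Cor3.5(ii)** (kurims p.95), the vertical inclusion `Ψ_ξ ⊆ ∞Ψ_ξ` of the third display for the
printed `∞Ψ_ξ`: if `θ ∈ ∞θ^ι_env` then `Ψ^×_{⟨F_l^⋇⟩} · ξ^ℕ ≤ Ψ^×_{⟨F_l^⋇⟩} · ξ^{ℚ≥0}`. [cite: Mochizuki2012, Cor 3.5 (ii) p.95] -/
theorem gaussianMonoid_le_inftyArising (θ : A) (Θ : Set A) (r : T → (A →* M)) (hθ : θ ∈ Θ) :
    gaussianMonoid (fun t => r t θ) ≤ unitDiagonal T M ⊔ Submonoid.closure (MonoidHom.pi r '' Θ) := by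
  refine sup_le_sup_left ?_ _
  rw [Submonoid.powers_le]
  exact Submonoid.subset_closure ⟨θ, hθ, funext fun t => rfl⟩

/-! ### 2. "The middle horizontal arrow is an isomorphism of monoids" -/

/-- **IUTchII:Cor3.5(ii)** (kurims p.95): injectivity of the product of the restriction morphisms from
injectivity at ONE label (Kummer theory at `D^δ_{t₀,μ_-}`). [cite: Mochizuki2012, Cor 3.5 (ii) p.95] -/
theorem pi_injective_of_injective_at (r : T → (A →* M)) (t₀ : T) (hinj : Function.Injective (r t₀)) :
    Function.Injective (MonoidHom.pi r) := fun x y hxy =>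
  hinj (by simpa only [MonoidHom.pi_apply] using congrFun hxy t₀)

/-- **IUTchII:Cor3.5(ii)** (kurims p.95) "`∞Ψ^ι_env(M^Θ_*) ⥲ ∞Ψ_ξ(M^Θ_*)` … isomorphisms of monoids": for the source
monoid `M^×_TM · ⟨∞θ^ι_env⟩` and restriction injective at one label, an isomorphism ONTO the printed `∞Ψ_ξ`
whose underlying map IS the restriction `x ↦ (r_t x)_t` (pinned, not a bare existence claim).
[cite: Mochizuki2012, Cor 3.5 (ii) p.95] -/
theorem exists_inftyRestrictionIso (U : Submonoid A) (Θ : Set A) (r : T → (A →* M))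
    (hgen : U ⊔ Submonoid.closure Θ = ⊤)
    (hU : ∀ u ∈ U, ∃ m : Mˣ, ∀ t, r t u = m) (hUsurj : ∀ m : Mˣ, ∃ u ∈ U, ∀ t, r t u = m)
    (t₀ : T) (hinj : Function.Injective (r t₀)) :
    ∃ e : A ≃* (unitDiagonal T M ⊔ Submonoid.closure (MonoidHom.pi r '' Θ) : Submonoid (T → M)),
      ∀ x, ((e x : (unitDiagonal T M ⊔ Submonoid.closure (MonoidHom.pi r '' Θ) : Submonoid (T → M))) :
        T → M) = MonoidHom.pi r x := by
  have hbij : Function.Bijective (MonoidHom.pi r).mrangeRestrict :=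
    ⟨fun x y hxy => pi_injective_of_injective_at r t₀ hinj (congrArg Subtype.val hxy),
      (MonoidHom.pi r).mrangeRestrict_surjective⟩
  exact ⟨(MulEquiv.ofBijective _ hbij).trans
      (MulEquiv.submonoidCongr (mrange_pi_eq_inftyArising U Θ r hgen hU hUsurj)), fun x => rfl⟩

/-- **IUTchII:Cor3.5(ii)** (kurims p.95): a restriction isomorphism is UNIQUE among isomorphisms whose
underlying map is the restriction. [cite: Mochizuki2012, Cor 3.5 (ii) p.95] -/
theorem inftyRestrictionIso_unique {S' : Submonoid (T → M)} (r : T → (A →* M)) (e e' : A ≃* S')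
    (he : ∀ x, ((e x : S') : T → M) = MonoidHom.pi r x)
    (he' : ∀ x, ((e' x : S') : T → M) = MonoidHom.pi r x) : e = e' :=
  MulEquiv.ext fun x => Subtype.ext ((he x).trans (he' x).symm)

end Arising

/-! ### 3. The typed `∞Ψ^ι_env(M^Θ_*)` of Proposition 3.1, and the `∞`-row of Cor 3.6 (ii) -/

section ThetaEnv

variable {P : Type u} [Group P] (E : TemperedThetaMonoids.ThetaEnvData.{u, v} P) {T : Type w} {M : Type*}
  [CommMonoid M]

/-- **IUTchII:Prop3.1(i)** (kurims p.87) "`∞Ψ^ι_env(M^Θ_*) = M^×_TM(M^Θ_*) · ∞θ^ι_env(M^Θ_*)^ℕ` … generated … by the subset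
`M^×_TM · ∞θ^ι_env`": read INSIDE the monoid `∞Ψ^ι_env`, its unit part and its roots generate it.
[cite: Mochizuki2012, Prop 3.1 (i) p.87] -/
theorem inftyThetaMonoid_unitPart_sup_roots_eq_top (ι : E.Iota) :
    (E.units.toSubmonoid.comap (E.inftyThetaMonoid ι).subtype) ⊔
        Submonoid.closure ((E.inftyThetaMonoid ι).subtype ⁻¹' E.inftyThetaEnv ι) = ⊤ := by
  have hU : E.units.toSubmonoid ≤ E.inftyThetaMonoid ι := le_sup_left
  have hΘ : E.inftyThetaEnv ι ⊆ E.inftyThetaMonoid ι := fun x hx =>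
    Submonoid.mem_sup_right (Submonoid.subset_closure hx)
  have himg : Subtype.val '' (Subtype.val ⁻¹' E.inftyThetaEnv ι : Set (E.inftyThetaMonoid ι)) =
      E.inftyThetaEnv ι := by
    ext x
    constructor
    · rintro ⟨y, hy, rfl⟩
      exact hy
    · intro hx
      exact ⟨⟨x, hΘ hx⟩, hx, rfl⟩
  apply Submonoid.map_injective_of_injective (E.inftyThetaMonoid ι).subtype_injective
  rw [Submonoid.map_sup, MonoidHom.map_mclosure, ← MonoidHom.mrange_eq_map, Submonoid.mrange_subtype,
    Submonoid.map_comap_eq_self (by rwa [Submonoid.mrange_subtype]), Submonoid.coe_subtype, himg]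
  rfl

/-- **IUTchII:Cor3.5(ii)** (kurims p.95) for the typed `∞Ψ^ι_env(M^Θ_*)` (`ThetaEnvData.inftyThetaMonoid`), restriction
morphisms `r_t : ∞Ψ^ι_env →* Ψ_cns,t = M` typed OUT OF THE MONOID (units `Mˣ = Ψ^×_cns`; theta values may be
non-units): the IMAGE of the restriction is the printed `∞Ψ_ξ = Ψ^×_{⟨F_l^⋇⟩} · ξ^{ℚ≥0}`, `ξ^{ℚ≥0}` generated by the
restrictions of the elements of `∞θ^ι_env`. [cite: Mochizuki2012, Cor 3.5 (ii) p.95] -/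
theorem mrange_inftyRestriction_eq (ι : E.Iota) (r : T → (E.inftyThetaMonoid ι →* M))
    (hU : ∀ u : E.inftyThetaMonoid ι, (u : E.H) ∈ E.units → ∃ m : Mˣ, ∀ t, r t u = m)
    (hUsurj : ∀ m : Mˣ, ∃ u : E.inftyThetaMonoid ι, (u : E.H) ∈ E.units ∧ ∀ t, r t u = m) :
    MonoidHom.mrange (MonoidHom.pi r) = unitDiagonal T M ⊔
      Submonoid.closure (MonoidHom.pi r '' ((E.inftyThetaMonoid ι).subtype ⁻¹' E.inftyThetaEnv ι)) :=
  mrange_pi_eq_inftyArising _ _ r (inftyThetaMonoid_unitPart_sup_roots_eq_top E ι)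
    (fun u hu => hU u (Submonoid.mem_comap.mp hu)) fun m => by
      obtain ⟨u, hu, hm⟩ := hUsurj m
      exact ⟨u, Submonoid.mem_comap.mpr hu, hm⟩

/-- **IUTchII:Cor3.5(ii)** (kurims p.95) "the restriction operations … determine … `∞Ψ^ι_env(M^Θ_*) ⥲ ∞Ψ_ξ(M^Θ_*)` …
isomorphisms of monoids" for the typed `∞Ψ^ι_env`: given injectivity of the restriction at one label, a
UNIQUE isomorphism onto the printed `∞Ψ_ξ` whose underlying map is the restriction.
[cite: Mochizuki2012, Cor 3.5 (ii) p.95] -/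
theorem exists_unique_inftyRestrictionIso_inftyThetaMonoid (ι : E.Iota) (r : T → (E.inftyThetaMonoid ι →* M))
    (hU : ∀ u : E.inftyThetaMonoid ι, (u : E.H) ∈ E.units → ∃ m : Mˣ, ∀ t, r t u = m)
    (hUsurj : ∀ m : Mˣ, ∃ u : E.inftyThetaMonoid ι, (u : E.H) ∈ E.units ∧ ∀ t, r t u = m)
    (t₀ : T) (hinj : Function.Injective (r t₀)) :
    ∃! e : E.inftyThetaMonoid ι ≃*
        (unitDiagonal T M ⊔
          Submonoid.closure (MonoidHom.pi r '' ((E.inftyThetaMonoid ι).subtype ⁻¹' E.inftyThetaEnv ι)) :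
          Submonoid (T → M)),
      ∀ x, ((e x : (unitDiagonal T M ⊔
          Submonoid.closure (MonoidHom.pi r '' ((E.inftyThetaMonoid ι).subtype ⁻¹' E.inftyThetaEnv ι)) :
          Submonoid (T → M))) : T → M) = MonoidHom.pi r x := by
  obtain ⟨e, he⟩ := exists_inftyRestrictionIso _ _ r (inftyThetaMonoid_unitPart_sup_roots_eq_top E ι)
    (fun u hu => hU u (Submonoid.mem_comap.mp hu))
    (fun m => by
      obtain ⟨u, hu, hm⟩ := hUsurj m
      exact ⟨u, Submonoid.mem_comap.mpr hu, hm⟩) t₀ hinj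
  exact ⟨e, he, fun e' he' => inftyRestrictionIso_unique r e' e he' he⟩

/-- **IUTchII:Cor3.5(ii)** (kurims p.95): the printed `∞Ψ_ξ` for the typed `∞Ψ^ι_env` sits inside the statement
file's `inftyGaussianMonoid ξ`, `ξ = (r_t θ)_t`, whenever every element of `∞θ^ι_env` is a root of a power of
`θ` in `∞Ψ^ι_env` (so every landed INCLUSION statement is kept). [cite: Mochizuki2012, Cor 3.5 (ii) p.95] -/
theorem inftyArising_le_inftyGaussianMonoid_thetaEnv (ι : E.Iota) (r : T → (E.inftyThetaMonoid ι →* M))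
    (θ : E.inftyThetaMonoid ι)
    (hroot : ∀ x : E.inftyThetaMonoid ι, (x : E.H) ∈ E.inftyThetaEnv ι →
      ∃ a b : ℕ, 0 < a ∧ 0 < b ∧ x ^ a = θ ^ b) :
    unitDiagonal T M ⊔
        Submonoid.closure (MonoidHom.pi r '' ((E.inftyThetaMonoid ι).subtype ⁻¹' E.inftyThetaEnv ι)) ≤
      inftyGaussianMonoid (fun t => r t θ) :=
  inftyArising_le_inftyGaussianMonoid θ _ r fun x hx => hroot x hx

/-- **IUTchII:Cor3.5(ii)** (kurims p.95), compatibility of the two horizontal arrows with the vertical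
inclusions `Ψ^ι_env ⊆ ∞Ψ^ι_env`, `Ψ_ξ ⊆ ∞Ψ_ξ` of the third display: if the `Ψ`-level restriction is the `∞`-level
restriction composed with the inclusion, the two pinned isomorphisms agree on underlying families.
[cite: Mochizuki2012, Cor 3.5 (ii) p.95] -/
theorem restriction_inclusion_compatible {S Sinf : Submonoid E.H} (hle : S ≤ Sinf)
    (rinf : T → (Sinf →* M)) {S' Sinf' : Submonoid (T → M)} (e : S ≃* S') (einf : Sinf ≃* Sinf')
    (he : ∀ x, ((e x : S') : T → M) = MonoidHom.pi (fun t => (rinf t).comp (Submonoid.inclusion hle)) x)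
    (heinf : ∀ x, ((einf x : Sinf') : T → M) = MonoidHom.pi rinf x) (x : S) :
    ((einf (Submonoid.inclusion hle x) : Sinf') : T → M) = ((e x : S') : T → M) := by
  rw [he, heinf]
  rfl

variable {E} {F : TemperedFrobenioidThetaData.{u, v} P} (K : Prop33KummerStatements E F) {N : Type*}
  [CommMonoid N]

/-- **IUTchII:Cor3.6(ii)** (kurims p.100), `∞`-row "`∞Ψ_{†F^Θ_v,α} ⥲ ∞Ψ^ι_env(M^Θ_*) ⥲ ∞Ψ_ξ(M^Θ_*) ⥲ ∞Ψ_{F_ξ}(†F_v)`":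
from the REAL `∞`-Kummer isomorphism `kummerInftyTheta α` (Prop 3.3 (i), `Prop33KummerStatements`), an
`∞`-restriction isomorphism onto a submonoid `Sinf'` whose underlying map is the restriction (typed out of
the monoid), and the labeled Kummer copies `piIso T e`, the COMPOSITE isomorphism onto the
Frobenioid-theoretic copy `(piIso T e)⁻¹(Sinf')` exists and is pinned: read through `piIso T e` it IS
"restriction ∘ Kummer". [cite: Mochizuki2012, Cor 3.6 (ii) p.100] -/
theorem exists_inftyKummerRestrictionTransportIso (α : P) (r : T → (E.inftyThetaMonoid (K.label α) →* M))
    {Sinf' : Submonoid (T → M)} (eΨ : E.inftyThetaMonoid (K.label α) ≃* Sinf')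
    (heΨ : ∀ y, ((eΨ y : Sinf') : T → M) = MonoidHom.pi r y) (e : N ≃* M) :
    ∃ Φ : F.inftyFrobThetaMonoid α ≃* Sinf'.comap (piIso T e).toMonoidHom,
      ∀ x, piIso T e ((Φ x : Sinf'.comap (piIso T e).toMonoidHom) : T → N) =
        MonoidHom.pi r (K.kummerInftyTheta α x) := by
  have hmap : (Sinf'.comap (piIso T e).toMonoidHom).map (piIso T e : (T → N) →* (T → M)) = Sinf' := by
    rw [MulEquiv.toMonoidHom_eq_coe, Submonoid.map_comap_eq_of_surjective]
    exact (piIso T e).surjective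
  let ψ : Sinf'.comap (piIso T e).toMonoidHom ≃* Sinf' :=
    ((piIso T e).submonoidMap (Sinf'.comap (piIso T e).toMonoidHom)).trans (MulEquiv.submonoidCongr hmap)
  have hψ : ∀ x, ((ψ x : Sinf') : T → M) = piIso T e x := fun x => rfl
  refine ⟨(K.kummerInftyTheta α).trans (eΨ.trans ψ.symm), fun x => ?_⟩
  rw [MulEquiv.trans_apply, MulEquiv.trans_apply, ← hψ, MulEquiv.apply_symm_apply, heΨ]

end ThetaEnv

/-! ### 4. (v2) Injectivity at one label DERIVED from printed facts (`Ψ`-level analogue: abc-iut-w4-d017,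
d017-F1-1 follow-up), and the `∞`-restriction isomorphism of §3 with the datum `Function.Injective (r t₀)` replaced
by: restriction injective on `M^×_TM` (Kummer theory at `D^δ_{t,μ_-}`), the theta value a NON-unit of the
cancellative constant monoid `Ψ_cns,t ≅ O^▷` (positive valuation, Rmk 2.5.1), torsion of the ambient module inside
`M^×_TM` (roots of unity are units). -/

section InjectivityFromPrint

variable {H : Type u} [CommGroup H] {M : Type w} [CancelCommMonoid M]

/-- Every element of `⟨Θ⟩` is a root (positive root exponent) of a nonnegative power of `θ` when every element of
`Θ` is a root of a positive power of `θ`. [cite: Mochizuki2012, Cor 3.5 (ii) p.95] -/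
theorem exists_pow_eq_pow_of_mem_closure (θ : H) (Θ : Set H)
    (hroot : ∀ x ∈ Θ, ∃ a b : ℕ, 0 < a ∧ 0 < b ∧ x ^ a = θ ^ b) {s : H} (hs : s ∈ Submonoid.closure Θ) :
    ∃ a b : ℕ, 0 < a ∧ s ^ a = θ ^ b := by
  have hle : Submonoid.closure Θ ≤ rootPowers θ := by
    rw [Submonoid.closure_le]
    exact fun x hx => Submonoid.subset_closure (hroot x hx)
  rcases (mem_rootPowers_iff θ s).mp (hle hs) with rfl | ⟨a, b, ha, -, hab⟩
  · exact ⟨1, 0, Nat.one_pos, by simp⟩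
  · exact ⟨a, b, ha, hab⟩

/-- **IUTchII:Cor3.5(ii)** (kurims p.95): the restriction at one label is INJECTIVE on `∞Ψ^ι_env = M^×_TM · ⟨∞θ^ι_env⟩`
as soon as (a) it is injective on `M^×_TM`, (b) `r θ` is not a unit of the (c) cancellative constant monoid, and
(d) the torsion of the ambient module lies in `M^×_TM`. [cite: Mochizuki2012, Cor 3.5 (ii) p.95] -/
theorem injective_restriction_of_not_isUnit (U : Subgroup H) (θ : H) (Θ : Set H)
    (hroot : ∀ x ∈ Θ, ∃ a b : ℕ, 0 < a ∧ 0 < b ∧ x ^ a = θ ^ b) (hθ : θ ∈ Θ)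
    (r : splitMonoid U (Submonoid.closure Θ) →* M)
    (hUinj : ∀ (u u' : H) (hu : u ∈ U) (hu' : u' ∈ U),
      r ⟨u, Submonoid.mem_sup_left hu⟩ = r ⟨u', Submonoid.mem_sup_left hu'⟩ → u = u')
    (hnu : ¬ IsUnit (r ⟨θ, Submonoid.mem_sup_right (Submonoid.subset_closure hθ)⟩))
    (htor : ∀ τ : H, IsOfFinOrder τ → τ ∈ U) :
    Function.Injective r := by
  have hθS : θ ∈ splitMonoid U (Submonoid.closure Θ) := Submonoid.mem_sup_right (Submonoid.subset_closure hθ)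
  have hUS : ∀ {u : H}, u ∈ U → u ∈ splitMonoid U (Submonoid.closure Θ) := fun hu => Submonoid.mem_sup_left hu
  have hunit : ∀ (u : H) (hu : u ∈ U), IsUnit (r ⟨u, hUS hu⟩) := by
    intro u hu
    refine IsUnit.of_mul_eq_one (r ⟨u⁻¹, hUS (U.inv_mem hu)⟩) ?_
    rw [← map_mul, ← r.map_one]
    congr 1
    exact Subtype.ext (mul_inv_cancel u)
  have hdec : ∀ x : splitMonoid U (Submonoid.closure Θ), ∃ (u : H) (_ : u ∈ U) (s : H) (a b : ℕ),
      0 < a ∧ s ^ a = θ ^ b ∧ (x : H) = u * s := by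
    intro x
    obtain ⟨u, hu, s, hs, hx⟩ := (mem_splitMonoid_iff U _ (x : H)).mp x.2
    obtain ⟨a, b, ha, hab⟩ := exists_pow_eq_pow_of_mem_closure θ Θ hroot hs
    exact ⟨u, hu, s, a, b, ha, hab, hx.symm⟩
  have hpow : ∀ (x : splitMonoid U (Submonoid.closure Θ)) (u : H) (hu : u ∈ U) (s : H) (a b c : ℕ),
      s ^ a = θ ^ b → (x : H) = u * s →
      r x ^ (a * c) = r ⟨u ^ (a * c), hUS (U.pow_mem hu _)⟩ * r ⟨θ, hθS⟩ ^ (b * c) := by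
    intro x u hu s a b c hab hx
    have hs : s ^ (a * c) = θ ^ (b * c) := by rw [pow_mul, hab, ← pow_mul]
    rw [← map_pow, ← map_pow, ← map_mul]
    congr 1
    apply Subtype.ext
    simp only [SubmonoidClass.coe_pow, Submonoid.coe_mul]
    rw [hx, mul_pow, hs]
  intro x y hxy
  obtain ⟨u, hu, s, a, b, ha, hab, hx⟩ := hdec x
  obtain ⟨u', hu', s', c, d, hc, hcd, hy⟩ := hdec y
  have ex := hpow x u hu s a b c hab hx
  have ey := hpow y u' hu' s' c d a hcd hy
  rw [mul_comm c a] at ey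
  have hac : r ⟨u ^ (a * c), hUS (U.pow_mem hu _)⟩ * r ⟨θ, hθS⟩ ^ (b * c) =
      r ⟨u' ^ (a * c), hUS (U.pow_mem hu' _)⟩ * r ⟨θ, hθS⟩ ^ (d * a) := by
    rw [← ex, ← ey, hxy]
  have key : ∀ (v v' : H) (hv : v ∈ U) (hv' : v' ∈ U) (m k : ℕ),
      r ⟨v, hUS hv⟩ * r ⟨θ, hθS⟩ ^ m = r ⟨v', hUS hv'⟩ * r ⟨θ, hθS⟩ ^ (m + (k + 1)) → False := by
    intro v v' hv hv' m k h
    rw [pow_add, ← mul_assoc, mul_right_comm] at h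
    have h1 : r ⟨v, hUS hv⟩ = r ⟨v', hUS hv'⟩ * r ⟨θ, hθS⟩ ^ (k + 1) := mul_right_cancel h
    have hu1 : IsUnit (r ⟨v', hUS hv'⟩ * r ⟨θ, hθS⟩ ^ (k + 1)) := h1 ▸ hunit v hv
    exact hnu ((isUnit_pow_iff (Nat.succ_ne_zero k)).mp (isUnit_of_mul_isUnit_right hu1))
  have hbd : b * c = d * a := by
    by_contra hne
    rcases Nat.lt_or_gt_of_ne hne with hlt | hgt
    · obtain ⟨k, hk⟩ := Nat.exists_eq_add_of_lt hlt
      have hk' : d * a = b * c + (k + 1) := by omega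
      rw [hk'] at hac
      exact key _ _ (U.pow_mem hu _) (U.pow_mem hu' _) _ _ hac
    · obtain ⟨k, hk⟩ := Nat.exists_eq_add_of_lt hgt
      have hk' : b * c = d * a + (k + 1) := by omega
      rw [hk'] at hac
      exact key _ _ (U.pow_mem hu' _) (U.pow_mem hu _) _ _ hac.symm
  have hxpow : (x : H) ^ (a * c) = u ^ (a * c) * θ ^ (b * c) := by
    rw [hx, mul_pow, show s ^ (a * c) = θ ^ (b * c) by rw [pow_mul, hab, ← pow_mul]]
  have hypow : (y : H) ^ (a * c) = u' ^ (a * c) * θ ^ (b * c) := by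
    rw [hy, mul_pow, show s' ^ (a * c) = θ ^ (b * c) by
      rw [hbd, mul_comm a c, pow_mul, hcd, ← pow_mul]]
  have hτn : ((x : H) * (y : H)⁻¹ * (u' * u⁻¹)) ^ (a * c) = 1 := by
    rw [mul_pow, mul_pow, inv_pow, mul_pow, inv_pow, hxpow, hypow]
    group
  have hτU : (x : H) * (y : H)⁻¹ * (u' * u⁻¹) ∈ U :=
    htor _ (isOfFinOrder_iff_pow_eq_one.mpr ⟨a * c, Nat.mul_pos ha hc, hτn⟩)
  have hσU : (x : H) * (y : H)⁻¹ * (u' * u⁻¹) * (u * u'⁻¹) ∈ U :=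
    U.mul_mem hτU (U.mul_mem hu (U.inv_mem hu'))
  have hxσy : (x : H) = (x : H) * (y : H)⁻¹ * (u' * u⁻¹) * (u * u'⁻¹) * (y : H) := by group
  have hxσy' : x = ⟨_, hUS hσU⟩ * y := Subtype.ext (by simpa only [Submonoid.coe_mul] using hxσy)
  have hrσ : r ⟨_, hUS hσU⟩ = r ⟨1, hUS U.one_mem⟩ := by
    have h1 : r ⟨_, hUS hσU⟩ * r y = 1 * r y := by rw [← map_mul, ← hxσy', hxy, one_mul]
    rw [mul_right_cancel h1, ← r.map_one]
    rfl
  have hσ1 := hUinj _ 1 hσU U.one_mem hrσ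
  rw [hxσy']
  refine Subtype.ext ?_
  simp only [Submonoid.coe_mul, hσ1, one_mul]

end InjectivityFromPrint

section ThetaEnvFromPrint

variable {P : Type u} [Group P] (E : TemperedThetaMonoids.ThetaEnvData.{u, v} P) {T : Type w} {M : Type*}
  [CancelCommMonoid M]

/-- **IUTchII:Cor3.5(ii)** (kurims p.95) for the typed `∞Ψ^ι_env(M^Θ_*)`: the UNIQUE isomorphism `∞Ψ^ι_env ⥲ ∞Ψ_ξ` onto
the printed `∞Ψ_ξ` with underlying map the restriction, the injectivity at `t₀` being DERIVED from the printed facts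
(a)–(d) of `injective_restriction_of_not_isUnit`. [cite: Mochizuki2012, Cor 3.5 (ii) p.95] -/
theorem exists_unique_inftyRestrictionIso_inftyThetaMonoid_of_not_isUnit (ι : E.Iota)
    (r : T → (E.inftyThetaMonoid ι →* M))
    (hU : ∀ u : E.inftyThetaMonoid ι, (u : E.H) ∈ E.units → ∃ m : Mˣ, ∀ t, r t u = m)
    (hUsurj : ∀ m : Mˣ, ∃ u : E.inftyThetaMonoid ι, (u : E.H) ∈ E.units ∧ ∀ t, r t u = m)
    (t₀ : T) {θ : E.H} (hθ : θ ∈ E.inftyThetaEnv ι)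
    (hroot : ∀ x ∈ E.inftyThetaEnv ι, ∃ a b : ℕ, 0 < a ∧ 0 < b ∧ x ^ a = θ ^ b)
    (hUinj : ∀ (u u' : E.H) (hu : u ∈ E.units) (hu' : u' ∈ E.units),
      r t₀ ⟨u, Submonoid.mem_sup_left hu⟩ = r t₀ ⟨u', Submonoid.mem_sup_left hu'⟩ → u = u')
    (hnu : ¬ IsUnit (r t₀ ⟨θ, Submonoid.mem_sup_right (Submonoid.subset_closure hθ)⟩))
    (htor : ∀ τ : E.H, IsOfFinOrder τ → τ ∈ E.units) :
    ∃! e : E.inftyThetaMonoid ι ≃*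
        (unitDiagonal T M ⊔
          Submonoid.closure (MonoidHom.pi r '' ((E.inftyThetaMonoid ι).subtype ⁻¹' E.inftyThetaEnv ι)) :
          Submonoid (T → M)),
      ∀ x, ((e x : (unitDiagonal T M ⊔
          Submonoid.closure (MonoidHom.pi r '' ((E.inftyThetaMonoid ι).subtype ⁻¹' E.inftyThetaEnv ι)) :
          Submonoid (T → M))) : T → M) = MonoidHom.pi r x :=
  exists_unique_inftyRestrictionIso_inftyThetaMonoid E ι r hU hUsurj t₀
    (injective_restriction_of_not_isUnit E.units θ (E.inftyThetaEnv ι) hroot hθ (r t₀) hUinj hnu htor)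

end ThetaEnvFromPrint

end BadPrimeGaussianMonoids

end Literature.IUT.HodgeArakelov
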